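import Summits.MatrixMultiplication.MatrixMultiplication.Theorems.OutsiderSandwichWiringBridge
import HarnessLib

/-!
# The wiring dictionary is exact: `Helped N B ⟺ a B-copy wiring of X · Y`

Route `OutsiderSandwich` (decomposition cell `decomp-mm`, lens 4, gen 28, kernel 6), support for the
aside leaf `BlockOneIsMM` (stmt-MatrixMultiplication-27147); cut of record untouched; theorem-only.

`OutsiderSandwichWiringBridge` turned a restriction `⟨B⟩ ⊠ C₁^{⊠N} ⊵ ⟨2,2,2⟩^{⊠N}` into a wiring
`Σ_{(i,c)} R_{i,c}(τ_c(A_i X) · L_{i,c} Y) = X · Y`.  This file proves the converse, so that the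
finite problems `r(N) = min {B : Helped N B}` of the leaf are LITERALLY problems about wirings:

* `contract_source` — the source side of the bridge computation as a standalone identity;
* `coeffX A`, `coeffY L`, `coeffZ R` — restriction matrices read off a wiring, with
  `xLeg (coeffX A) = A`, `yLeg (coeffY L) = L`, `zLeg (coeffZ R) = R` (`xLeg_coeffX`, …);
* `restriction_of_wiring`, `helped_of_wiring` — a wiring over `Fin B × (ℤ/2)^N` gives `Helped N B`;
  `helped_iff_wiring` — the dictionary is an equivalence; `helped_of_wiring_on` — wirings summed
  over any block set `T`; `helped_of_wiring_card` — copies indexed by any finite type `ι`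
  (`Helped N |ι|`): the certificate interface for explicit small wirings (census side).

References: V. Strassen, J. reine angew. Math. 384 (1988), Thm. 3.8 [Strassen1988]; M. Bläser,
*Fast Matrix Multiplication*, ToC Graduate Surveys 5 (2013), §4–5 [Blaser2013].
-/

noncomputable section

open scoped BigOperators Matrix

set_option linter.dupNamespace false
set_option autoImplicit false

namespace Summit.MatrixMultiplication.MatrixMultiplication.Theorems.OutsiderSandwichWiringConverse

open Literature.Computability.AlgebraicComplexity
  Summit.MatrixMultiplication.MatrixMultiplication.Theorems.OutsiderSandwichCoupling
  Summit.MatrixMultiplication.MatrixMultiplication.Theorems.OutsiderSandwichBlockNormalForm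
  Summit.MatrixMultiplication.MatrixMultiplication.Theorems.OutsiderSandwichTwistGluing
  Summit.MatrixMultiplication.MatrixMultiplication.Theorems.OutsiderSandwichTwistSlices
  Summit.MatrixMultiplication.MatrixMultiplication.Theorems.OutsiderSandwichWiringBridge
open Summit.MatrixMultiplication.MatrixMultiplication.Theorems.OutsiderSandwichExchangeRate (Helped)

variable {N B : ℕ}

/-! ## 1. The source contraction, standalone -/

/-- Contracting `Σ α β γ · (⟨B⟩ ⊠ C₁^{⊠N})` against `Xᵀ ⊗ Y` at output index `enc(ν, μ)` gives the
`(μ, ν)` entry of the wiring sum built from the legs `xLeg α`, `yLeg β`, `zLeg γ`. -/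
theorem contract_source (α β γ : Tgt N → Fin B × Src N → ℂ) (X Y : Matrix (Idx N) (Idx N) ℂ)
    (μ ν : Idx N) :
    ∑ a' : Tgt N, ∑ b' : Tgt N, X (fun n => (a' n).2) (fun n => (a' n).1) *
        Y (fun n => (b' n).1) (fun n => (b' n).2) *
        ∑ a, ∑ b, ∑ c, α a' a * β b' b * γ (encP (ν, μ)) c *
          kroneckerTensor (unitTensor ℂ B) (kroneckerPow coupling₁ N) a b c =
      (∑ b : Fin B × Idx N, zLeg γ b.1 b.2
        (Matrix.mulVec (ptrans b.2 (xLeg α b.1 X)) (yLeg β b.1 b.2 Y))) μ ν := by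
  rw [Matrix.sum_apply]
  simp_rw [kroneckerTensor_apply]
  rw [contract_source_stage1, contract_source_stage2, Fintype.sum_prod_type]
  refine Finset.sum_congr rfl fun i _ => ?_
  calc ∑ a₂ : Src N, (∑ a', α a' (i, a₂) * X (fun n => (a' n).2) (fun n => (a' n).1)) *
        ∑ b₂ : Src N, (∑ b', β b' (i, b₂) * Y (fun n => (b' n).1) (fun n => (b' n).2)) *
          ∑ c₂ : Src N, γ (encP (ν, μ)) (i, c₂) * kroneckerPow coupling₁ N a₂ b₂ c₂
      = ∑ b₂ : Src N, (∑ b', β b' (i, b₂) * Y (fun n => (b' n).1) (fun n => (b' n).2)) *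
          ∑ c₂ : Src N, γ (encP (ν, μ)) (i, c₂) *
            ∑ a₂ : Src N, (∑ a', α a' (i, a₂) * X (fun n => (a' n).2) (fun n => (a' n).1)) *
              kroneckerPow coupling₁ N a₂ b₂ c₂ := by
        rw [← sum_mul_sum_comm]
        refine Finset.sum_congr rfl fun b₂ _ => ?_
        congr 1
        rw [← sum_mul_sum_comm]
    _ = ∑ b₂ : Src N, (∑ b', β b' (i, b₂) * Y (fun n => (b' n).1) (fun n => (b' n).2)) *
          ∑ c₂ : Src N, γ (encP (ν, μ)) (i, c₂) *
            (if ∀ n, half (c₂ n) = half (b₂ n) + 1 then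
              ptrans (fun n => half (b₂ n)) (xLeg α i X) (fun n => pos (c₂ n))
                (fun n => pos (b₂ n)) else 0) := by
        simp_rw [contract_source_stage3]
        rfl
    _ = ∑ c : Idx N, zLeg γ i c
          (Matrix.mulVec (ptrans c (xLeg α i X)) (yLeg β i c Y)) μ ν := by
        rw [contract_source_stage4]
        rfl

/-! ## 2. Restriction matrices of a wiring -/

section Coeff

variable (A : Fin B → Matrix (Idx N) (Idx N) ℂ →ₗ[ℂ] Matrix (Idx N) (Idx N) ℂ)
  (L : Fin B → Idx N → (Matrix (Idx N) (Idx N) ℂ →ₗ[ℂ] (Idx N → ℂ)))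
  (R : Fin B → Idx N → ((Idx N → ℂ) →ₗ[ℂ] Matrix (Idx N) (Idx N) ℂ))

/-- `α(a', (i, a)) = (A_i E_{a'₂ a'₁})_{half a, pos a}`. -/
def coeffX : Tgt N → Fin B × Src N → ℂ := fun a' a =>
  A a.1 (unitMat (fun n => (a' n).2) (fun n => (a' n).1)) (fun n => half (a.2 n)) (fun n => pos (a.2 n))

/-- `β(b', (i, b)) = (L_{i, half b} E_{b'₁ b'₂})_{pos b}`. -/
def coeffY : Tgt N → Fin B × Src N → ℂ := fun b' b =>
  L b.1 (fun n => half (b.2 n)) (unitMat (fun n => (b' n).1) (fun n => (b' n).2)) (fun n => pos (b.2 n))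

/-- `γ(c', (i, c)) = (R_{i, half c + 1} e_{pos c})_{c'₂ c'₁}`. -/
def coeffZ : Tgt N → Fin B × Src N → ℂ := fun c' c =>
  R c.1 ((fun n => half (c.2 n)) + 1) (fun j => if j = (fun n => pos (c.2 n)) then 1 else 0)
    (fun n => (c' n).2) (fun n => (c' n).1)

/-- `half ∘ enc(c, v) = c`. -/
theorem half_encH (c v : Idx N) : (fun n => half (encH (c, v) n)) = c :=
  funext fun n => half_symm (c n) (v n)

/-- `pos ∘ enc(c, v) = v`. -/
theorem pos_encH (c v : Idx N) : (fun n => pos (encH (c, v) n)) = v :=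
  funext fun n => pos_symm (c n) (v n)

/-- A matrix is the sum of its entries times matrix units. -/
theorem matrix_eq_sum_unitMat (X : Matrix (Idx N) (Idx N) ℂ) :
    X = ∑ q : Idx N, ∑ p : Idx N, X q p • (unitMat q p : Matrix (Idx N) (Idx N) ℂ) := by
  ext r s
  rw [Matrix.sum_apply]
  simp_rw [Matrix.sum_apply, Matrix.smul_apply, unitMat_apply, smul_eq_mul, mul_ite, mul_one,
    mul_zero]
  rw [Finset.sum_eq_single r]
  · rw [Finset.sum_eq_single s]
    · rw [if_pos ⟨rfl, rfl⟩]
    · intro p _ hp; rw [if_neg (fun h => hp h.2.symm)]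
    · intro h; exact absurd (Finset.mem_univ s) h
  · intro q _ hq
    exact Finset.sum_eq_zero fun p _ => by rw [if_neg (fun h => hq h.1.symm)]
  · intro h; exact absurd (Finset.mem_univ r) h

/-- A vector is the sum of its entries times coordinate vectors. -/
theorem vec_eq_sum_single (w : Idx N → ℂ) :
    w = ∑ o : Idx N, w o • (fun j => if j = o then (1 : ℂ) else 0) := by
  funext j
  rw [Finset.sum_apply]
  simp_rw [Pi.smul_apply, smul_eq_mul, mul_ite, mul_one, mul_zero]
  rw [Finset.sum_ite_eq Finset.univ j, if_pos (Finset.mem_univ j)]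

/-- In a double sum against `E_{q p}` read at `(a'₂, a'₁)`, only `a' = enc(p, q)` survives. -/
theorem sum_tgt_unit (p q : Idx N) (F : Tgt N → ℂ) :
    ∑ a' : Tgt N, (unitMat q p : Matrix (Idx N) (Idx N) ℂ) (fun n => (a' n).2) (fun n => (a' n).1) *
      F a' = F (encP (p, q)) := by
  rw [Finset.sum_eq_single (encP (p, q))]
  · rw [unitMat_apply, if_pos ⟨rfl, rfl⟩, one_mul]
  · intro a' _ ha
    rw [unitMat_apply, if_neg, zero_mul]
    rintro ⟨h2, h1⟩
    exact ha (funext fun n => Prod.ext (congrFun h1 n) (congrFun h2 n))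
  · intro h; exact absurd (Finset.mem_univ _) h

/-- Same with the unit read at `(b'₁, b'₂)`. -/
theorem sum_tgt_unit' (p q : Idx N) (F : Tgt N → ℂ) :
    ∑ b' : Tgt N, (unitMat p q : Matrix (Idx N) (Idx N) ℂ) (fun n => (b' n).1) (fun n => (b' n).2) *
      F b' = F (encP (p, q)) := by
  rw [Finset.sum_eq_single (encP (p, q))]
  · rw [unitMat_apply, if_pos ⟨rfl, rfl⟩, one_mul]
  · intro b' _ hb
    rw [unitMat_apply, if_neg, zero_mul]
    rintro ⟨h1, h2⟩
    exact hb (funext fun n => Prod.ext (congrFun h1 n) (congrFun h2 n))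
  · intro h; exact absurd (Finset.mem_univ _) h

/-- The `x`-leg of the read-off matrices is `A`. -/
theorem xLeg_coeffX (i : Fin B) (X : Matrix (Idx N) (Idx N) ℂ) : xLeg (coeffX A) i X = A i X := by
  ext r s
  change ∑ a' : Tgt N, coeffX A a' (i, encH (r, s)) * X (fun n => (a' n).2) (fun n => (a' n).1) =
    A i X r s
  simp only [coeffX, half_encH, pos_encH]
  conv_rhs => rw [matrix_eq_sum_unitMat X]
  rw [map_sum, Matrix.sum_apply]
  simp_rw [map_sum, Matrix.sum_apply, map_smul, Matrix.smul_apply, smul_eq_mul]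
  rw [Fintype.sum_equiv (tgtEquiv N)
    (fun a' : Tgt N => A i (unitMat (fun n => (a' n).2) (fun n => (a' n).1)) r s *
      X (fun n => (a' n).2) (fun n => (a' n).1))
    (fun pq : Idx N × Idx N => A i (unitMat pq.2 pq.1) r s * X pq.2 pq.1) (fun _ => rfl),
    Fintype.sum_prod_type, Finset.sum_comm]
  exact Finset.sum_congr rfl fun q _ => Finset.sum_congr rfl fun p _ => mul_comm _ _

/-- The `y`-leg of the read-off matrices is `L`. -/
theorem yLeg_coeffY (i : Fin B) (c : Idx N) (Y : Matrix (Idx N) (Idx N) ℂ) :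
    yLeg (coeffY L) i c Y = L i c Y := by
  funext v
  change ∑ b' : Tgt N, coeffY L b' (i, encH (c, v)) * Y (fun n => (b' n).1) (fun n => (b' n).2) =
    L i c Y v
  simp only [coeffY, half_encH, pos_encH]
  conv_rhs => rw [matrix_eq_sum_unitMat Y]
  rw [map_sum, Finset.sum_apply]
  simp_rw [map_sum, Finset.sum_apply, map_smul, Pi.smul_apply, smul_eq_mul]
  rw [Fintype.sum_equiv (tgtEquiv N)
    (fun b' : Tgt N => L i c (unitMat (fun n => (b' n).1) (fun n => (b' n).2)) v *
      Y (fun n => (b' n).1) (fun n => (b' n).2))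
    (fun pq : Idx N × Idx N => L i c (unitMat pq.1 pq.2) v * Y pq.1 pq.2) (fun _ => rfl),
    Fintype.sum_prod_type]
  exact Finset.sum_congr rfl fun q _ => Finset.sum_congr rfl fun p _ => mul_comm _ _

/-- The `z`-leg of the read-off matrices is `R`. -/
theorem zLeg_coeffZ (i : Fin B) (c : Idx N) (w : Idx N → ℂ) : zLeg (coeffZ R) i c w = R i c w := by
  ext μ ν
  change ∑ o : Idx N, coeffZ R (encP (ν, μ)) (i, encH (c + 1, o)) * w o = R i c w μ ν
  have h11 : c + 1 + 1 = c := by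
    funext n
    show c n + 1 + 1 = c n
    have : ∀ x : Fin 2, x + 1 + 1 = x := by decide
    exact this (c n)
  simp only [coeffZ, half_encH, pos_encH, h11]
  conv_rhs => rw [vec_eq_sum_single w]
  rw [map_sum, Matrix.sum_apply]
  simp_rw [map_smul, Matrix.smul_apply, smul_eq_mul]
  exact Finset.sum_congr rfl fun o _ => mul_comm _ _

/-! ## 3. Wiring ⟹ restriction -/

/-- **A wiring is a restriction.**  If `Σ_{(i,c)} R_{i,c}(τ_c(A_i X) · L_{i,c} Y) = X · Y` for all
`X, Y`, then the read-off matrices restrict `⟨B⟩ ⊠ C₁^{⊠N}` to `⟨2,2,2⟩^{⊠N}`. -/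
theorem restriction_of_wiring
    (ident : ∀ X Y : Matrix (Idx N) (Idx N) ℂ, ∑ b : Fin B × Idx N,
      R b.1 b.2 (Matrix.mulVec (ptrans b.2 (A b.1 X)) (L b.1 b.2 Y)) = X * Y)
    (a' b' c' : Tgt N) :
    kroneckerPow (matMulTensor ℂ 2 2 2) N a' b' c' =
      ∑ a, ∑ b, ∑ c, coeffX A a' a * coeffY L b' b * coeffZ R c' c *
        kroneckerTensor (unitTensor ℂ B) (kroneckerPow coupling₁ N) a b c := by
  -- name the bit patterns of the three target indices
  have hc : encP (fun n => (c' n).1, fun n => (c' n).2) = c' := rfl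
  rw [← hc]
  set p : Idx N := fun n => (a' n).1
  set q : Idx N := fun n => (a' n).2
  set p' : Idx N := fun n => (b' n).1
  set q' : Idx N := fun n => (b' n).2
  set ν : Idx N := fun n => (c' n).1
  set μ : Idx N := fun n => (c' n).2
  have ha : encP (p, q) = a' := rfl
  have hb : encP (p', q') = b' := rfl
  -- both trilinear forms have the same contraction against `E_{q p}ᵀ ⊗ E_{p' q'}`
  have h1 := contract_matMul (unitMat q p : Matrix (Idx N) (Idx N) ℂ) (unitMat p' q') μ ν
  have h2 := contract_source (coeffX A) (coeffY L) (coeffZ R)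
    (unitMat q p : Matrix (Idx N) (Idx N) ℂ) (unitMat p' q') μ ν
  have h3 : (∑ b : Fin B × Idx N, zLeg (coeffZ R) b.1 b.2 (Matrix.mulVec
      (ptrans b.2 (xLeg (coeffX A) b.1 (unitMat q p : Matrix (Idx N) (Idx N) ℂ)))
      (yLeg (coeffY L) b.1 b.2 (unitMat p' q')))) = unitMat q p * unitMat p' q' := by
    rw [← ident]
    exact Finset.sum_congr rfl fun b _ => by rw [xLeg_coeffX, yLeg_coeffY, zLeg_coeffZ]
  rw [h3] at h2
  simp_rw [mul_assoc, ← Finset.mul_sum, sum_tgt_unit', sum_tgt_unit] at h1 h2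
  rw [ha, hb] at h1 h2
  rw [h1, ← h2]
  simp only [Finset.mul_sum, mul_assoc]

/-- **`Helped N B` from a wiring** over `Fin B × (ℤ/2)^N`. -/
theorem helped_of_wiring
    (ident : ∀ X Y : Matrix (Idx N) (Idx N) ℂ, ∑ b : Fin B × Idx N,
      R b.1 b.2 (Matrix.mulVec (ptrans b.2 (A b.1 X)) (L b.1 b.2 Y)) = X * Y) : Helped N B :=
  ⟨coeffX A, coeffY L, coeffZ R, restriction_of_wiring A L R ident⟩

end Coeff

/-- **The dictionary is exact**: `Helped N B ⟺` some `B`-copy wiring computes `X · Y`. -/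
theorem helped_iff_wiring :
    Helped N B ↔ ∃ (A : Fin B → Matrix (Idx N) (Idx N) ℂ →ₗ[ℂ] Matrix (Idx N) (Idx N) ℂ)
      (L : Fin B → Idx N → (Matrix (Idx N) (Idx N) ℂ →ₗ[ℂ] (Idx N → ℂ)))
      (R : Fin B → Idx N → ((Idx N → ℂ) →ₗ[ℂ] Matrix (Idx N) (Idx N) ℂ)),
      ∀ X Y : Matrix (Idx N) (Idx N) ℂ, ∑ b : Fin B × Idx N,
        R b.1 b.2 (Matrix.mulVec (ptrans b.2 (A b.1 X)) (L b.1 b.2 Y)) = X * Y :=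
  ⟨wiring_of_helped, fun ⟨A, L, R, ident⟩ => helped_of_wiring A L R ident⟩

/-- **Wirings over a block set `T`** (unused blocks simply absent) also certify `Helped`. -/
theorem helped_of_wiring_on {ι : Type*} [Fintype ι] [DecidableEq ι]
    (A : ι → Matrix (Idx N) (Idx N) ℂ →ₗ[ℂ] Matrix (Idx N) (Idx N) ℂ) (T : Finset (ι × Idx N))
    (L : ι → Idx N → (Matrix (Idx N) (Idx N) ℂ →ₗ[ℂ] (Idx N → ℂ)))
    (R : ι → Idx N → ((Idx N → ℂ) →ₗ[ℂ] Matrix (Idx N) (Idx N) ℂ))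
    (ident : ∀ X Y : Matrix (Idx N) (Idx N) ℂ, ∑ b ∈ T,
      R b.1 b.2 (Matrix.mulVec (ptrans b.2 (A b.1 X)) (L b.1 b.2 Y)) = X * Y) :
    Helped N (Fintype.card ι) := by
  classical
  -- zero the unused `y`-legs, then reindex the copies by `Fin |ι|`
  set L' : ι → Idx N → (Matrix (Idx N) (Idx N) ℂ →ₗ[ℂ] (Idx N → ℂ)) :=
    fun i c => if (i, c) ∈ T then L i c else 0 with hL'
  have identU : ∀ X Y : Matrix (Idx N) (Idx N) ℂ, ∑ b : ι × Idx N,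
      R b.1 b.2 (Matrix.mulVec (ptrans b.2 (A b.1 X)) (L' b.1 b.2 Y)) = X * Y := by
    intro X Y
    rw [← ident X Y, ← Finset.sum_subset (Finset.subset_univ T)]
    · refine Finset.sum_congr rfl fun b hb => ?_
      have : L' b.1 b.2 = L b.1 b.2 := by rw [hL']; exact if_pos hb
      rw [this]
    · intro b _ hb
      have : L' b.1 b.2 = 0 := by rw [hL']; exact if_neg hb
      rw [this, LinearMap.zero_apply, Matrix.mulVec_zero, map_zero]
  set e := Fintype.equivFin ι
  refine helped_of_wiring (fun j => A (e.symm j)) (fun j => L' (e.symm j)) (fun j => R (e.symm j))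
    fun X Y => ?_
  rw [← identU X Y, ← (Equiv.prodCongr e (Equiv.refl (Idx N))).symm.sum_comp]
  rfl

end Summit.MatrixMultiplication.MatrixMultiplication.Theorems.OutsiderSandwichWiringConverse
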